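import Mathlib
import HarnessLib
import Literature.AlgebraicGeometry.Ramification.InertiaNormalSylow
import Literature.AlgebraicGeometry.Resolution.Blowups
import Summits.ResolutionOfSingularities.ResolutionOfSingularities.Theorems.WildQuotientsWildQuotientResolutionStubInertiaLe
import Summits.ResolutionOfSingularities.ResolutionOfSingularities.Theorems.WildQuotientsWildQuotientResolutionPointMoveNpcFinite

/-!
# Finiteness of the non-p-closed locus persists under point moves on a regular threefold (crux `WildQuotients.WildQuotientResolution`)

Crux stmt-ResolutionOfSingularities-15640 (`WildQuotientResolution`), registered stub
`stub_phaseZeroHighDim`, move-game track (`…PointMove` p810587). Quantitative round invariant of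
the terminating design (memo `PHASE0-DIM3-TERMINATION.md` §3, addendum v2 (R2)/(R8)): for the
equivariant blow-up `π : X♯ → X′` of a finite stable set `Z` of closed points (regular threefold
at `Z`, residue characteristics `p`), **if `NPC(X′)` is finite then `NPC(X♯)` is finite**:
over `Z` it is finite by ✓`finite_npc_over_centre`; off `Z`, `π` is an isomorphism
(`IsBlowup.isIso_compl`), hence injective, and maps non-p-closed points to non-p-closed points
(`I_x ≤ I_{π x}`, ✓`InertiaLe.stub_inertia_le`), so `NPC(X♯) ∖ π⁻¹Z` injects into `NPC(X′)`.

* `injOn_base_compl_preimage_centre` — `π` is injective off `π⁻¹ Z`.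
* `finite_npc_of_pointMove` — the invariant step.

[OURS · crux stmt-ResolutionOfSingularities-15640 · helper toward `stub_phaseZeroHighDim`
(threefold Phase 0, round bookkeeping); folklore, counted 0; AI-level work, weaker than expert
review.]
-/

-- single-problem summit: the doubled namespace component `ResolutionOfSingularities` is forced
set_option linter.dupNamespace false

namespace Summit.ResolutionOfSingularities.ResolutionOfSingularities.Theorems.WildQuotientResolution.PointMoveNoNpcCurves

open CategoryTheory AlgebraicGeometry TopologicalSpace IsLocalRing
open Literature.AlgebraicGeometry.Resolution Literature.AlgebraicGeometry.Ramification

/-- **A blow-up of a closed set `Z` is injective off `π⁻¹ Z`** (it is an isomorphism over the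
complement of its centre, `IsBlowup.isIso_compl`). [folklore; StacksProject 02OS] -/
theorem injOn_base_compl_preimage_centre {X' Xs : Scheme.{0}} {Z : Set X'} (hZc : IsClosed Z)
    {π : Xs ⟶ X'} (hπ : IsBlowup π (Scheme.IdealSheafData.vanishingIdeal ⟨Z, hZc⟩)) :
    Set.InjOn π.base {x : Xs | π.base x ∉ Z} := by
  set W₀ : X'.Opens := ⟨((Scheme.IdealSheafData.vanishingIdeal (⟨Z, hZc⟩ : Closeds X')).support :
      Set X')ᶜ, (Scheme.IdealSheafData.vanishingIdeal (⟨Z, hZc⟩ : Closeds X')).support.isClosed.isOpen_compl⟩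
    with hW₀
  haveI : IsIso (π ∣_ W₀) := hπ.isIso_compl
  have hmemW : ∀ y : Xs, y ∈ π ⁻¹ᵁ W₀ ↔ π.base y ∉ Z := fun y => by
    change π.base y ∈ ((Scheme.IdealSheafData.vanishingIdeal (⟨Z, hZc⟩ : Closeds X')).support :
      Set X')ᶜ ↔ _
    rw [Scheme.IdealSheafData.coe_support_vanishingIdeal]
    rfl
  have hinj : Function.Injective (π ∣_ W₀).base :=
    (TopCat.homeoOfIso (asIso (π ∣_ W₀).base)).injective
  intro x hx x' hx' hxx'
  have heq : (⟨x, (hmemW x).mpr hx⟩ : π ⁻¹ᵁ W₀) = ⟨x', (hmemW x').mpr hx'⟩ := by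
    apply hinj
    apply Subtype.ext
    rw [morphismRestrict_base_coe, morphismRestrict_base_coe]
    exact hxx'
  exact congrArg Subtype.val heq

/-- **Finiteness of the non-p-closed locus persists under point moves (regular threefold).**
Setting of ✓`finite_npc_over_centre` (threefold/characteristic hypotheses pointwise over `Z`); if
the non-p-closed locus of `X′` is finite, so is that of `X♯`. [folklore] -/
theorem finite_npc_of_pointMove (p : ℕ) [Fact p.Prime]
    {X' X₁ : Scheme.{0}} (q : X' ⟶ X₁) [IsAffineHom q]
    {G : Type} [Group G] [Finite G] (ρ : G →* Aut X') (hfaith : Function.Injective ρ)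
    (hρ : ∀ g : G, (ρ g).hom ≫ q = q) [IsIntegral X'] [IsLocallyNoetherian X']
    [JacobsonSpace X']
    {Z : Set X'} (hZc : IsClosed Z) (hZf : Z.Finite) (hZpt : ∀ z ∈ Z, IsClosed ({z} : Set X'))
    {Xs : Scheme.{0}} {π : Xs ⟶ X'}
    (hπ : IsBlowup π (Scheme.IdealSheafData.vanishingIdeal ⟨Z, hZc⟩)) [IsIntegral Xs]
    [JacobsonSpace Xs] [NoetherianSpace Xs]
    (ρs : G →* Aut Xs) (hequiv : ∀ g : G, (ρs g).hom ≫ π = π ≫ (ρ g).hom)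
    (hcharZ : ∀ x : Xs, π.base x ∈ Z → CharP (ResidueField (X'.presheaf.stalk (π.base x))) p)
    (hcharX : ∀ x : Xs, π.base x ∈ Z → CharP (ResidueField (Xs.presheaf.stalk x)) p)
    (hregZ : ∀ x : Xs, π.base x ∈ Z → IsRegularLocalRing (X'.presheaf.stalk (π.base x)))
    (hdimZ : ∀ x : Xs, π.base x ∈ Z → ringKrullDim (X'.presheaf.stalk (π.base x)) = (3 : ℕ))
    (hfin : ({y : X' | ¬ HasNormalSylow p (inertiaSubgroup ρ y)}).Finite) :
    ({x : Xs | ¬ HasNormalSylow p (inertiaSubgroup ρs x)}).Finite := by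
  -- split over / off the centre
  have hsplit : {x : Xs | ¬ HasNormalSylow p (inertiaSubgroup ρs x)} ⊆
      {x : Xs | π.base x ∈ Z ∧ ¬ HasNormalSylow p (inertiaSubgroup ρs x)} ∪
        {x : Xs | π.base x ∉ Z ∧ ¬ HasNormalSylow p (inertiaSubgroup ρs x)} := by
    intro x hx
    by_cases h : π.base x ∈ Z
    · exact Or.inl ⟨h, hx⟩
    · exact Or.inr ⟨h, hx⟩
  refine Set.Finite.subset (Set.Finite.union ?_ ?_) hsplit
  · exact finite_npc_over_centre p q ρ hfaith hρ hZc hZf hZpt hπ ρs hequiv hcharZ hcharX hregZ hdimZ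
  · -- off `Z`: inject into `NPC(X′)` by `π`
    refine Set.Finite.of_finite_image (hfin.subset ?_) ((injOn_base_compl_preimage_centre hZc hπ).mono
      fun x hx => hx.1)
    rintro _ ⟨x, ⟨-, hx⟩, rfl⟩
    exact fun h => hx ((h.subgroup ((inertiaSubgroup ρs x).subgroupOf
      (inertiaSubgroup ρ (π.base x)))).of_mulEquiv
        (Subgroup.subgroupOfEquivOfLe (InertiaLe.stub_inertia_le ρs ρ π hequiv x)))

end Summit.ResolutionOfSingularities.ResolutionOfSingularities.Theorems.WildQuotientResolution.PointMoveNoNpcCurves
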